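import Summits.Ventures.PercRepro.RankLevelSetLevelSixT21Cell7
import Summits.Ventures.PercRepro.RankLevelSetLevelSixT21Cell8
import Summits.Ventures.PercRepro.RankLevelSetLevelSixT21Cell9
import Summits.Ventures.PercRepro.RankLevelSetLevelSixT21Cell10
import Summits.Ventures.PercRepro.RankLevelSetLevelSixT21Cell11
import Summits.Ventures.PercRepro.RankLevelSetLevelSixT21Cell12
import Summits.Ventures.PercRepro.RankLevelSetLevelSixT21Cell13
import Summits.Ventures.PercRepro.RankLevelSetLevelSixT21Cell14
import Summits.Ventures.PercRepro.RankLevelSetLevelSixT21Cell15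
import Summits.Ventures.PercRepro.RankLevelSetLevelSixT21Cell16
import Summits.Ventures.PercRepro.RankLevelSetLevelSixT21Cell17
import Summits.Ventures.PercRepro.RankLevelSetLevelSixT21Cell18
import Summits.Ventures.PercRepro.RankLevelSetLevelSixT21Cell19
import Summits.Ventures.PercRepro.RankLevelSetLevelSixT21Cell20
import Summits.Ventures.PercRepro.RankLevelSetLevelSixT21Cell21
import Summits.Ventures.PercRepro.RankLevelSetLevelSixT21BasisMid1
import Summits.Ventures.PercRepro.RankLevelSetLevelSixT21BasisMid2
import Summits.Ventures.PercRepro.RankLevelSetLevelSixT21BasisMid3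
import Summits.Ventures.PercRepro.RankLevelSetLevelSixT21RegII
import Summits.Ventures.PercRepro.RankLevelSetLevelSixT22AssemblyFour
import Summits.Ventures.PercRepro.RankLevelSetLevelFiveCqFifteen

/-!
# PercRepro — THE 21 ROW: `c025_six_large_twenty_one (21 ≤ p) : RLS M p 6` — C-025 AT LEVEL `6` FOR EVERY `p ≥ 21`, EVERY FINITE MATROID (p8 g15, S3)

`proofs/SUBCLAIM-S3-p8.md` §3z⁗⁗⁗″. The core cells `(21, d)`: `7 ≤ d ≤ 21` by THE COLOOP DEVICE WITH THE LP CHAIN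
(`c025_core_six_twentyone_d`: `k = 0` and the chain `1 ≤ k ≤ K` the coloop-free cells of p2's nullity-split coloop/closure LP run
at level `6` (`S3LP.s6lp_*`, rows `21 … 16`), then the exported-count rows and the trivial rows), `22 ≤ d ≤ 41` by the basis cells
(`c025_core_six_t21_basis_mid1/2/3`), `d ≥ 42` by regime II
(`c025_core_six_regII_basis_21`). Then the level-5 glue as in the 22 row: `rls_six_at_of_core 21` on p7's
`c025_five_large_sharp15` (level `5` at `p = 20`) and the 22 row (`c025_six_large_twenty_two`) for `p ≥ 22`.
Axioms: standard.
-/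

open scoped Matroid

namespace PercRepro

namespace ThmN

variable {α : Type}

/-- **The core cell `(21, d)` at every corank `d ≥ 22`, every `e`-free core** (the basis cells and regime II). -/
theorem c025_core_six_twentyone_large (M : Matroid α) [M.Finite] (d : ℕ) (hd22 : 22 ≤ d)
    (hR : M.eRank = (21 : ℕ∞)) (hn : M.E.ncard = 21 + d)
    (hfree : ∀ e ∈ M.E, ∃ A ⊆ M.E \ {e}, e ∉ M.closure A ∧ e ∉ M.closure ((M.E \ {e}) \ A)) :
    RLS M 21 6 := by
  rcases Nat.lt_or_ge d 31 with h30 | h31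
  · exact c025_core_six_t21_basis_mid1 M d hd22 (by omega) hR hn hfree
  rcases Nat.lt_or_ge d 40 with h39 | h40
  · exact c025_core_six_t21_basis_mid2 M d h31 (by omega) hR hn hfree
  rcases Nat.lt_or_ge d 42 with h41 | h42
  · exact c025_core_six_t21_basis_mid3 M d h40 (by omega) hR hn hfree
  · exact c025_core_six_regII_basis_21 M d h42 hR hn hfree

/-- **The core cell `(21, d)` at every corank `d ≥ 7`, every `e`-free core.** -/
theorem c025_core_six_twentyone (M : Matroid α) [M.Finite] (d : ℕ) (hd7 : 7 ≤ d)
    (hR : M.eRank = (21 : ℕ∞)) (hn : M.E.ncard = 21 + d)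
    (hfree : ∀ e ∈ M.E, ∃ A ⊆ M.E \ {e}, e ∉ M.closure A ∧ e ∉ M.closure ((M.E \ {e}) \ A)) :
    RLS M 21 6 := by
  rcases Nat.lt_or_ge d 22 with hlt | hge
  · interval_cases d
    · exact c025_core_six_twentyone_7 M hR hn hfree
    · exact c025_core_six_twentyone_8 M hR hn hfree
    · exact c025_core_six_twentyone_9 M hR hn hfree
    · exact c025_core_six_twentyone_10 M hR hn hfree
    · exact c025_core_six_twentyone_11 M hR hn hfree
    · exact c025_core_six_twentyone_12 M hR hn hfree
    · exact c025_core_six_twentyone_13 M hR hn hfree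
    · exact c025_core_six_twentyone_14 M hR hn hfree
    · exact c025_core_six_twentyone_15 M hR hn hfree
    · exact c025_core_six_twentyone_16 M hR hn hfree
    · exact c025_core_six_twentyone_17 M hR hn hfree
    · exact c025_core_six_twentyone_18 M hR hn hfree
    · exact c025_core_six_twentyone_19 M hR hn hfree
    · exact c025_core_six_twentyone_20 M hR hn hfree
    · exact c025_core_six_twentyone_21 M hR hn hfree
  · exact c025_core_six_twentyone_large M d hge hR hn hfree

/-- **THEOREM C₆ AT RANK `21`, GIVEN LEVEL `5`**: level `5` for all `p ≥ 20` implies level `6` for all `p ≥ 21`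
(`p = 21` by the cells and `rls_six_at_of_core`; `p ≥ 22` by the 22 row). -/
theorem c025_six_of_five_t21
    (h5 : ∀ (M : Matroid α) [M.Finite] (p : ℕ), 20 ≤ p → RLS M p 5) :
    ∀ (M : Matroid α) [M.Finite] (p : ℕ), 21 ≤ p → RLS M p 6 := by
  intro M _ p hp
  rcases Nat.lt_or_ge p 22 with hlt | hge
  · have hP : p = 21 := by omega
    subst hP
    refine rls_six_at_of_core 21 (by norm_num) (fun M _ => h5 M 20 (by norm_num)) ?_ M
    intro M _ d hd hR hn hfree
    exact c025_core_six_twentyone M d hd hR hn hfree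
  · exact c025_six_large_twenty_two M p hge

/-- **C-025 AT LEVEL `6` FOR EVERY `p ≥ 21`, EVERY FINITE MATROID** — on p7's `c025_five_large_sharp15 (15 ≤ p)`. -/
theorem c025_six_large_twenty_one (M : Matroid α) [M.Finite] (p : ℕ) (hp : 21 ≤ p) : RLS M p 6 :=
  c025_six_of_five_t21 (fun M _ p hp => c025_five_large_sharp15 M p (by omega)) M p hp

end ThmN

end PercRepro
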